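import Literature.NumberTheory.LFunctions.WeilSeriesZ
import Literature.NumberTheory.LFunctions.WeilFirstPrimeDataCells
import HarnessLib

/-!
# Minorant cells checked by integer series sums (Stage C cells)

Topic: `Literature/NumberTheory/LFunctions`. A second checker for the cells of certified minorants
of the Weil weights (`WeilCell` of `WeilPositivityMinorant.lean`, `FPDCell` of
`WeilFirstPrimeDataCells.lean`), for dyadic left end points `u = a/2^j`:

* `WeilCell.checkZ p j` — the digamma part: `W ≤ wLoZ` (integer series + integral-test tail,
  `WeilSeriesZ.lean`, `WeilDigammaTails.lean`), coefficients against `aLoZ/aHiZ`, and the tail of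
  the increments credited to the linear coefficient (`linTailLoQ`, valid as `v ≤ l_{ma}`);
  soundness `WeilCell.sigma_le_Z` (`σ ≤ Re ψ(1/4 + it/2)` on the cell);
* `FPDCell.checkZ p j` — the same digamma check plus the (unchanged) ripple checks of
  `FPDCell.check`; soundness `FPDCell.sigma_le_Z` (`σ ≤ w₂` on the cell), and the check-free forms
  `FPDCell.abs_level_sub_sigma_le_of`, `FPDCell.bndQ_nonneg_of` of the signed-`γ` bounds.

The polynomial `σ`, the moments and `bndQ` are those of the existing structures, so the chain,
moment and certificate layers apply verbatim. Everything here is proved; no named facts.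

## References

* H. Yoshida, *On Hermitian forms attached to zeta functions*, Adv. Stud. Pure Math. 21 (1992), §6.
  [Yoshida1992]
* R. E. Moore, *Interval Analysis* (1966), Ch. 3. [Moore1966]
-/

noncomputable section

open Real Set Finset
open scoped BigOperators

namespace Literature.NumberTheory.LFunctions

open Literature.Analysis.SpecialFunctions
open Literature.Analysis.ValidatedNumerics.Numerics

/-! ## The digamma cell, integer checker -/

/-- The numerator `a` of a dyadic `u = a/2^j` (meaningful when `u · 2^j ∈ ℕ`, which is checked). [folklore] -/
def dyNum (u : ℚ) (j : ℕ) : ℕ := (u * 2 ^ j).num.toNat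

namespace WeilCell

/-- Coefficient checks against the integer series sums: `c_0 ≤ A_0^lo + tail`, `c_k ≤ A_k^lo`
(`k` even), `A_k^hi ≤ −c_k` (`k` odd). [folklore] -/
def checkCoeffsZ (p j : ℕ) (c : WeilCell) : Bool :=
  (c.c.length % 2 == 0) &&
    allBelow c.c.length fun k ↦
      if k = 0 then
        decide (c.coeff 0 ≤ ((aLoZ p (dyNum c.u j) j c.ma 0 : ℕ) : ℚ) / 2 ^ p + linTailLoQ c.v c.ma)
      else if k % 2 = 0 then decide (c.coeff k ≤ ((aLoZ p (dyNum c.u j) j c.ma k : ℕ) : ℚ) / 2 ^ p)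
      else decide (((aHiZ p (dyNum c.u j) j c.ma k : ℕ) : ℚ) / 2 ^ p ≤ -c.coeff k)

/-- **Integer cell check** (polynomial cells with dyadic `u = a/2^j`, `j ≥ 1`): `0 ≤ u < v ≤ l_{ma}`,
`W ≤ wLoZ`, and the coefficient checks. No level test. [folklore] -/
def checkZ (p j : ℕ) (c : WeilCell) : Bool :=
  decide (1 ≤ j) && decide (0 ≤ c.u) && decide (c.u < c.v) &&
    decide (c.u * 2 ^ j = ((dyNum c.u j : ℕ) : ℚ)) && decide (c.v ≤ digammaNodeQ c.ma) &&
    decide (c.W ≤ wLoZ p (dyNum c.u j) j c.mw) && c.checkCoeffsZ p j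

variable {p j : ℕ} {c : WeilCell}

/-- Unpacking `checkZ`. [folklore] -/
theorem checkZ_spec (h : c.checkZ p j = true) :
    1 ≤ j ∧ 0 ≤ c.u ∧ c.u < c.v ∧ c.u * 2 ^ j = ((dyNum c.u j : ℕ) : ℚ) ∧ c.v ≤ digammaNodeQ c.ma ∧
      c.W ≤ wLoZ p (dyNum c.u j) j c.mw ∧ c.checkCoeffsZ p j = true := by
  simp only [checkZ, Bool.and_eq_true, decide_eq_true_eq] at h
  exact ⟨h.1.1.1.1.1.1, h.1.1.1.1.1.2, h.1.1.1.1.2, h.1.1.1.2, h.1.1.2, h.1.2, h.2⟩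

/-- A `Z`-checked cell has `0 ≤ u`. [folklore] -/
theorem u_nonneg_Z (h : c.checkZ p j = true) : 0 ≤ c.u := (checkZ_spec h).2.1

/-- A `Z`-checked cell has `u < v`. [folklore] -/
theorem u_lt_v_Z (h : c.checkZ p j = true) : c.u < c.v := (checkZ_spec h).2.2.1

/-- The dyadic representation `u = a/2^j` certified by the check. [folklore] -/
theorem u_eq_dyNum (h : c.checkZ p j = true) : ((dyNum c.u j : ℕ) : ℝ) / 2 ^ j = (c.u : ℝ) := by
  have h4 := (checkZ_spec h).2.2.2.1
  have : (c.u : ℝ) * 2 ^ j = ((dyNum c.u j : ℕ) : ℝ) := by exact_mod_cast h4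
  rw [← this, mul_div_assoc, div_self (by positivity), mul_one]

/-- A `Z`-checked cell has `W ≤ Re ψ(1/4 + iu/2)`. [folklore] -/
theorem W_le_Z (h : c.checkZ p j = true) : ((c.W : ℚ) : ℝ) ≤ reDigammaQuarter c.u := by
  obtain ⟨hj, -, -, -, -, hW, -⟩ := checkZ_spec h
  have h1 := wLoZ_le p (dyNum c.u j) hj c.mw
  rw [u_eq_dyNum h] at h1
  exact le_trans (by exact_mod_cast hW) h1

/-- **Cell soundness (integer checker).** On its cell, `σ(t) ≤ Re ψ(1/4 + it/2)`. [folklore] -/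
theorem sigma_le_Z (h : c.checkZ p j = true) {t : ℝ} (hut : (c.u : ℝ) ≤ t) (htv : t ≤ (c.v : ℝ)) :
    c.sigma t ≤ reDigammaQuarter t := by
  obtain ⟨hj, huq, huvq, -, hvq, -, hc⟩ := checkZ_spec h
  have hu : (0 : ℝ) ≤ c.u := by exact_mod_cast huq
  have hW := W_le_Z h
  have hs0 : 0 ≤ t ^ 2 - (c.u : ℝ) ^ 2 := by nlinarith
  have hvM : (c.v : ℝ) ≤ digammaNode c.ma := by
    rw [← digammaNodeQ_cast]; exact_mod_cast hvq
  have hua : ((dyNum c.u j : ℕ) : ℝ) / 2 ^ j = (c.u : ℝ) := u_eq_dyNum h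
  unfold checkCoeffsZ at hc
  simp only [Bool.and_eq_true, beq_iff_eq] at hc
  obtain ⟨hlen, hall⟩ := hc
  obtain ⟨r, hr⟩ : ∃ r, c.c.length = 2 * r := ⟨c.c.length / 2, by omega⟩
  have h1 := reDigammaQuarter_sub_ge_sum_poly_add_tail hu hut htv c.ma r hvM
  rw [Finset.sum_comm] at h1
  set s : ℝ := t ^ 2 - (c.u : ℝ) ^ 2 with hs
  set A : ℕ → ℝ := fun k ↦ ∑ m ∈ Finset.range c.ma,
    2 * digammaNode m / (digammaNode m ^ 2 + (c.u : ℝ) ^ 2) ^ (k + 2) with hA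
  set tail : ℝ := 1 / (2 * (digammaNode c.ma ^ 2 + (c.v : ℝ) ^ 2)) with htail
  have htail0 : 0 ≤ tail := by rw [htail]; have := digammaNode_pos c.ma; positivity
  -- the inner sums, factored
  have hfac : ∀ k, ∑ m ∈ Finset.range c.ma,
      (-1) ^ k * (2 * digammaNode m) * s ^ (k + 1) /
        (digammaNode m ^ 2 + (c.u : ℝ) ^ 2) ^ (k + 2) = (-1) ^ k * A k * s ^ (k + 1) := by
    intro k
    rw [hA]; simp only
    rw [Finset.mul_sum, Finset.sum_mul]
    exact Finset.sum_congr rfl fun m _ ↦ by ring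
  simp only [hfac] at h1
  -- termwise comparison with an `ite` carrying the tail on `k = 0`
  have h2 : ∑ k ∈ Finset.range c.c.length, ((c.coeff k : ℚ) : ℝ) * s ^ (k + 1) ≤
      ∑ k ∈ Finset.range (2 * r), ((-1) ^ k * A k * s ^ (k + 1) + if k = 0 then s * tail else 0) := by
    rw [hr]
    refine Finset.sum_le_sum fun k hk ↦ ?_
    have hk' : k < c.c.length := by rw [hr]; exact Finset.mem_range.1 hk
    have hPk := of_allBelow hall hk'
    have hsk : 0 ≤ s ^ (k + 1) := pow_nonneg hs0 _
    by_cases hk0 : k = 0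
    · subst hk0
      simp only [↓reduceIte, decide_eq_true_eq] at hPk
      simp only [↓reduceIte, pow_zero, one_mul, zero_add, pow_one]
      have hlo := aLoZ_le p (dyNum c.u j) hj c.ma 0
      rw [hua] at hlo
      have hc0 : ((c.coeff 0 : ℚ) : ℝ) ≤ A 0 + tail := by
        have h01 := (Rat.cast_le (K := ℝ)).2 hPk
        push_cast at h01
        rw [linTailLoQ_cast, ← htail] at h01
        have h02 : ((aLoZ p (dyNum c.u j) j c.ma 0 : ℕ) : ℝ) / 2 ^ p + tail ≤ A 0 + tail := by
          rw [hA]; simpa using add_le_add hlo (le_refl tail)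
        exact h01.trans h02
      nlinarith
    · simp only [hk0, ↓reduceIte, add_zero] at hPk ⊢
      refine mul_le_mul_of_nonneg_right ?_ hsk
      rcases Nat.even_or_odd k with he | ho
      · have hk2 : k % 2 = 0 := Nat.even_iff.1 he
        simp only [hk2, ↓reduceIte, decide_eq_true_eq] at hPk
        rw [he.neg_one_pow, one_mul]
        have hlo := aLoZ_le p (dyNum c.u j) hj c.ma k
        rw [hua] at hlo
        have hPk' := (Rat.cast_le (K := ℝ)).2 hPk
        push_cast at hPk'
        rw [hA]
        exact hPk'.trans hlo
      · have hk1 : k % 2 = 1 := Nat.odd_iff.1 ho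
        simp only [hk1, one_ne_zero, ↓reduceIte, decide_eq_true_eq] at hPk
        rw [ho.neg_one_pow, neg_one_mul]
        have hhi := le_aHiZ p (dyNum c.u j) hj c.ma k
        rw [hua] at hhi
        have h' := (Rat.cast_le (K := ℝ)).2 hPk
        push_cast at h'
        rw [hA]
        linarith
  rw [Finset.sum_add_distrib, Finset.sum_ite_eq'] at h2
  have h3 : (if (0 : ℕ) ∈ Finset.range (2 * r) then s * tail else 0) ≤ s * tail := by
    split_ifs
    · exact le_rfl
    · exact mul_nonneg hs0 htail0
  have h4 : s * tail = s / (2 * (digammaNode c.ma ^ 2 + (c.v : ℝ) ^ 2)) := by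
    rw [htail]; ring
  unfold sigma
  have hsum : ∑ k ∈ Finset.range c.c.length, ((c.coeff k : ℚ) : ℝ) * (t ^ 2 - (c.u : ℝ) ^ 2) ^ (k + 1) =
      ∑ k ∈ Finset.range c.c.length, ((c.coeff k : ℚ) : ℝ) * s ^ (k + 1) := by rw [hs]
  rw [hsum]
  linarith

end WeilCell

/-! ## The first-prime cell, integer checker -/

namespace FPDCell

variable (c : FPDCell)

/-- All checks of a first-prime cell, integer form: the digamma part by `WeilCell.checkZ`, then
`n ≥ 1`, `0 ≤ Llo`, `(v − u) · Lhi ≤ 1`, and the claimed constants against the engine. [folklore] -/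
def checkZ (p j : ℕ) : Bool :=
  c.psi.checkZ p j && decide (0 < c.n) && decide (0 ≤ c.Llo) &&
    decide ((c.psi.v - c.psi.u) * c.Lhi ≤ 1) &&
    decide (c.Llo ≤ logTwoLoQ) && decide (logTwoHiQ ≤ c.Lhi) &&
    decide (c.alo ≤ alphaLoQ c.psi.u) && decide (c.blo ≤ betaLoQ c.psi.u)

variable {c} {p j : ℕ}

/-- Unpacking `checkZ`. [folklore] -/
theorem checkZ_spec (h : c.checkZ p j = true) :
    c.psi.checkZ p j = true ∧ 0 < c.n ∧ 0 ≤ c.Llo ∧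
      (c.psi.v - c.psi.u) * c.Lhi ≤ 1 ∧
      c.Llo ≤ logTwoLoQ ∧ logTwoHiQ ≤ c.Lhi ∧ c.alo ≤ alphaLoQ c.psi.u ∧ c.blo ≤ betaLoQ c.psi.u := by
  simp only [checkZ, Bool.and_eq_true, decide_eq_true_eq] at h
  exact ⟨h.1.1.1.1.1.1.1, h.1.1.1.1.1.1.2, h.1.1.1.1.1.2, h.1.1.1.1.2, h.1.1.1.2, h.1.1.2, h.1.2, h.2⟩

/-- A `Z`-checked cell has `0 ≤ u`. [folklore] -/
theorem u_nonneg_Z (h : c.checkZ p j = true) : 0 ≤ c.psi.u :=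
  WeilCell.u_nonneg_Z (checkZ_spec h).1

/-- A `Z`-checked cell has `u < v`. [folklore] -/
theorem u_lt_v_Z (h : c.checkZ p j = true) : c.psi.u < c.psi.v :=
  WeilCell.u_lt_v_Z (checkZ_spec h).1

/-- **Ripple soundness from the unpacked side conditions.** On the cell,
`P(t − u) ≤ −√2 log 2 cos(t log 2)`. [folklore] -/
theorem polyR_cosPart_le_of (hn : 0 < c.n) (hL0q : 0 ≤ c.Llo)
    (hwq : (c.psi.v - c.psi.u) * c.Lhi ≤ 1) (hLloq : c.Llo ≤ logTwoLoQ) (hLhiq : logTwoHiQ ≤ c.Lhi)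
    (haloq : c.alo ≤ alphaLoQ c.psi.u) (hbloq : c.blo ≤ betaLoQ c.psi.u)
    {t : ℝ} (hut : (c.psi.u : ℝ) ≤ t) (htv : t ≤ (c.psi.v : ℝ)) :
    polyR c.cosPart (t - c.psi.u) ≤ -(Real.sqrt 2 * Real.log 2 * Real.cos (t * Real.log 2)) := by
  set L : ℝ := Real.log 2 with hLdef
  set u : ℝ := (c.psi.u : ℝ) with hudef
  set hh : ℝ := t - u with hhdef
  have hL0 : (0 : ℝ) ≤ c.Llo := by exact_mod_cast hL0q
  have hL1 : (c.Llo : ℝ) ≤ L := le_trans (by exact_mod_cast hLloq) logTwo_mem_Q.1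
  have hL2 : L ≤ (c.Lhi : ℝ) := le_trans logTwo_mem_Q.2 (by exact_mod_cast hLhiq)
  have hLnn : 0 ≤ L := hL0.trans hL1
  have hh0 : 0 ≤ hh := by rw [hhdef]; linarith
  have hhw : hh ≤ (c.psi.v : ℝ) - c.psi.u := by rw [hhdef, hudef]; linarith
  have hhL : hh * L ≤ 1 := by
    have h1 : hh * L ≤ ((c.psi.v : ℝ) - c.psi.u) * c.Lhi :=
      mul_le_mul hhw hL2 hLnn (by linarith)
    have h2 : ((c.psi.v : ℝ) - c.psi.u) * c.Lhi ≤ 1 := by exact_mod_cast hwq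
    linarith
  have hy0 : 0 ≤ hh * L := mul_nonneg hh0 hLnn
  have hcos0 : 0 ≤ Real.cos (hh * L) :=
    Real.cos_nonneg_of_mem_Icc ⟨by linarith [Real.pi_pos], by linarith [Real.pi_gt_three]⟩
  have hsin0 : 0 ≤ Real.sin (hh * L) :=
    Real.sin_nonneg_of_nonneg_of_le_pi hy0 (by linarith [Real.pi_gt_three])
  set α : ℝ := -(Real.sqrt 2 * Real.log 2 * Real.cos (u * L)) with hαdef
  set β : ℝ := Real.sqrt 2 * Real.log 2 * Real.sin (u * L) with hβdef
  have hadd : -(Real.sqrt 2 * Real.log 2 * Real.cos (t * Real.log 2)) =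
      α * Real.cos (hh * L) + β * Real.sin (hh * L) := by
    have : t * Real.log 2 = u * L + hh * L := by rw [hhdef, hLdef]; ring
    rw [this, Real.cos_add, hαdef, hβdef]
    ring
  have ha : (c.alo : ℝ) ≤ α := by
    rw [hαdef, hudef, hLdef]; exact le_trans (by exact_mod_cast haloq) (alphaLoQ_le c.psi.u)
  have hb : (c.blo : ℝ) ≤ β := by
    rw [hβdef, hudef, hLdef]; exact le_trans (by exact_mod_cast hbloq) (betaLoQ_le c.psi.u)
  rw [hadd, polyR_cosPart]
  refine add_le_add ?_ ?_
  · unfold cosBracket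
    split_ifs with hsgn
    · have h0 : (0 : ℝ) ≤ c.alo := by exact_mod_cast hsgn
      calc (c.alo : ℝ) * polyR (cosLoCoeffs c.Llo c.Lhi c.n) hh
          ≤ (c.alo : ℝ) * Real.cos (hh * L) :=
            mul_le_mul_of_nonneg_left (polyR_cosLo_le hL0 hL1 hL2 hh0 hhL hn) h0
        _ ≤ α * Real.cos (hh * L) := mul_le_mul_of_nonneg_right ha hcos0
    · push Not at hsgn
      have h0 : (c.alo : ℝ) ≤ 0 := by exact_mod_cast hsgn.le
      calc (c.alo : ℝ) * polyR (cosUpCoeffs c.Llo c.Lhi c.n) hh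
          ≤ (c.alo : ℝ) * Real.cos (hh * L) :=
            mul_le_mul_of_nonpos_left (cos_le_polyR_cosUp hL0 hL1 hL2 hh0 hhL hn) h0
        _ ≤ α * Real.cos (hh * L) := mul_le_mul_of_nonneg_right ha hcos0
  · unfold sinBracket
    split_ifs with hsgn
    · have h0 : (0 : ℝ) ≤ c.blo := by exact_mod_cast hsgn
      calc (c.blo : ℝ) * polyR (sinLoCoeffs c.Llo c.Lhi c.n) hh
          ≤ (c.blo : ℝ) * Real.sin (hh * L) :=
            mul_le_mul_of_nonneg_left (polyR_sinLo_le hL0 hL1 hL2 hh0 hhL hn) h0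
        _ ≤ β * Real.sin (hh * L) := mul_le_mul_of_nonneg_right hb hsin0
    · push Not at hsgn
      have h0 : (c.blo : ℝ) ≤ 0 := by exact_mod_cast hsgn.le
      calc (c.blo : ℝ) * polyR (sinUpCoeffs c.Llo c.Lhi c.n) hh
          ≤ (c.blo : ℝ) * Real.sin (hh * L) :=
            mul_le_mul_of_nonpos_left (sin_le_polyR_sinUp hL0 hL1 hL2 hh0 hhL hn) h0
        _ ≤ β * Real.sin (hh * L) := mul_le_mul_of_nonneg_right hb hsin0

/-- **Cell soundness (integer checker).** On its cell, `σ(t) ≤ Re ψ(1/4 + it/2) − √2 log 2 cos(t log 2)`. [folklore] -/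
theorem sigma_le_Z (h : c.checkZ p j = true) {t : ℝ} (hut : (c.psi.u : ℝ) ≤ t)
    (htv : t ≤ (c.psi.v : ℝ)) :
    c.sigma t ≤ reDigammaQuarter t - Real.sqrt 2 * Real.log 2 * Real.cos (t * Real.log 2) := by
  obtain ⟨hpsi, hn, hL0q, hwq, hLloq, hLhiq, haloq, hbloq⟩ := checkZ_spec h
  have h1 := WeilCell.sigma_le_Z hpsi hut htv
  have h2 := polyR_cosPart_le_of hn hL0q hwq hLloq hLhiq haloq hbloq hut htv
  unfold sigma
  linarith

/-- `|σ_ψ(t) − W| ≤ Σ |c_k| (v² − u²)^{k+1}` on the cell (from `0 ≤ u` only). [folklore] -/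
theorem abs_psi_sigma_sub_W_le_of (hu0 : 0 ≤ c.psi.u) {t : ℝ} (hut : (c.psi.u : ℝ) ≤ t)
    (htv : t ≤ (c.psi.v : ℝ)) : |c.psi.sigma t - c.psi.W| ≤ c.psiAbsIncQ := by
  have hu : (0 : ℝ) ≤ c.psi.u := by exact_mod_cast hu0
  have hs0 : 0 ≤ t ^ 2 - (c.psi.u : ℝ) ^ 2 := by nlinarith
  have hsmax : t ^ 2 - (c.psi.u : ℝ) ^ 2 ≤ (c.psi.v : ℝ) * c.psi.v - (c.psi.u : ℝ) * c.psi.u := by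
    nlinarith
  unfold WeilCell.sigma psiAbsIncQ
  rw [add_sub_cancel_left, sumR_eq_sum]
  push_cast
  refine (Finset.abs_sum_le_sum_abs _ _).trans (Finset.sum_le_sum fun k _ ↦ ?_)
  rw [abs_mul, abs_pow, abs_of_nonneg hs0]
  exact mul_le_mul_of_nonneg_left (pow_le_pow_left₀ hs0 hsmax _) (abs_nonneg _)

/-- **Signed-`γ` control** (from `0 ≤ u` only). On the cell, `|wL − σ(t)| ≤ bndQ wL`. [folklore] -/
theorem abs_level_sub_sigma_le_of (hu0 : 0 ≤ c.psi.u) (wL : ℚ) {t : ℝ} (hut : (c.psi.u : ℝ) ≤ t)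
    (htv : t ≤ (c.psi.v : ℝ)) : |(wL : ℝ) - c.sigma t| ≤ c.bndQ wL := by
  have h1 := abs_psi_sigma_sub_W_le_of hu0 hut htv
  have hlen : c.cosPart.length = c.n + 1 := by simp [cosPart, tabV]
  have h2 := abs_polyR_le c.cosPart (h := t - c.psi.u) (w := (c.psi.v : ℝ) - c.psi.u)
    (by linarith) (by linarith)
  rw [hlen, ← absPartQ_cast] at h2
  unfold sigma bndQ
  push_cast
  have e : (wL : ℝ) - (c.psi.sigma t + polyR c.cosPart (t - c.psi.u)) =
      ((wL : ℝ) - c.psi.W) - (c.psi.sigma t - c.psi.W) - polyR c.cosPart (t - c.psi.u) := by ring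
  rw [e]
  exact (abs_sub _ _).trans (add_le_add ((abs_sub _ _).trans (add_le_add le_rfl h1)) h2)

/-- `0 ≤ bndQ` (from `0 ≤ u < v` only). [folklore] -/
theorem bndQ_nonneg_of (hu : 0 ≤ c.psi.u) (huv : c.psi.u < c.psi.v) (wL : ℚ) : 0 ≤ c.bndQ wL := by
  have h1 : 0 ≤ c.psi.v * c.psi.v - c.psi.u * c.psi.u := by nlinarith
  have h2 : 0 ≤ c.psi.v - c.psi.u := by linarith
  unfold bndQ psiAbsIncQ absPartQ
  rw [sumR_eq_sum, sumR_eq_sum]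
  exact add_nonneg (add_nonneg (abs_nonneg _)
    (Finset.sum_nonneg fun k _ ↦ mul_nonneg (abs_nonneg _) (pow_nonneg h1 _)))
    (Finset.sum_nonneg fun k _ ↦ mul_nonneg (abs_nonneg _) (pow_nonneg h2 _))

/-- Signed-`γ` control for a `Z`-checked cell. [folklore] -/
theorem abs_level_sub_sigma_le_Z (h : c.checkZ p j = true) (wL : ℚ) {t : ℝ}
    (hut : (c.psi.u : ℝ) ≤ t) (htv : t ≤ (c.psi.v : ℝ)) : |(wL : ℝ) - c.sigma t| ≤ c.bndQ wL :=
  abs_level_sub_sigma_le_of (u_nonneg_Z h) wL hut htv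

/-- `0 ≤ bndQ` for a `Z`-checked cell. [folklore] -/
theorem bndQ_nonneg_Z (h : c.checkZ p j = true) (wL : ℚ) : 0 ≤ c.bndQ wL :=
  bndQ_nonneg_of (u_nonneg_Z h) (u_lt_v_Z h) wL

end FPDCell

end Literature.NumberTheory.LFunctions
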